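import Summits.QuantumAdvantage.QuantumAdvantage.Theses.OddPrimeWalk
import Summits.QuantumAdvantage.AdviceFreeQNC0.EliminationHardnessF

/-!
# Route OddPrimeWalk — aside `ElimHardFOdd` (item stmt-QuantumAdvantage-22733) closes from the tree

`ElimHardFOdd := ∀ p prime, 5 ≤ p → ElimHardF p` is the landed theorem
`Summit.QuantumAdvantage.AdviceFreeQNC0.elimHardF (p) (hp3 : p ≠ 3)` (`EliminationHardnessF.lean`, p567244:
level-set elimination of `|u| mod 3` is impossible at polylog `𝔽_p`-degree, from Srinivasan's robust Hegedűs
lemma with scale `q = p^j`), specialised to `p ≥ 5` (so `p ≠ 3`).  Seat qa-qnc0-prover gen 10.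
-/

set_option linter.dupNamespace false

namespace Summit.QuantumAdvantage.QuantumAdvantage.Theorems

/-- Item stmt-QuantumAdvantage-22733 `ElimHardFOdd` of route OddPrimeWalk: for every prime `p ≥ 5`,
`ElimHardF p` — by `AdviceFreeQNC0.elimHardF` (`p ≠ 3` since `5 ≤ p`). -/
theorem elimHardFOdd_proof : Summit.QuantumAdvantage.QuantumAdvantage.Theses.OddPrimeWalk.ElimHardFOdd :=
  fun p _ hp => Summit.QuantumAdvantage.AdviceFreeQNC0.elimHardF p (by omega)

end Summit.QuantumAdvantage.QuantumAdvantage.Theorems
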